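import Summits.HodgeConjecture.HodgeConjecture.Theorems.VHCAbelianSchemesRoadMoverTrapDefs
import Literature.AlgebraicGeometry.Motives.AbelianVarietySimpleOfEndAlgebraDomain
import Literature.AlgebraicGeometry.Motives.AbelianVarietyImageSimpleProofs
import HarnessLib

/-!
# Road №4 (`VHCAbelianSchemesRoad`), crux stmt-HodgeConjecture-26512 — lens line «negation» (mover trap), kernel node S3:
# `End J = ℤ ⟹ (J × Ĵ, φ_d)` IS K-SIMPLE (no `φ_d`-stable abelian subvariety of dimension strictly between `0` and `6`)

research route conditional on HC_CM; not a corollary; Q11.4-sentence-2 already refuted in dim ≥ 3.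
NOTHING here says S1, S2, S4, (c4a), (c4a-E) `PrintSheafHandleExistsEnd`, the crux, №4, HC_AV, HC_CM or HC holds; HC_CM HELD, by name only.

This file PROVES the statement of the Cruxes workfile's stub `stub_KSimple_of_endTrivial` (`Lines/MoverTrap.lean` fdaab6dae2d2c84a, §2 (S3))
VERBATIM, against the Theorems-lane vocabulary `Theorems/VHCAbelianSchemesRoadMoverTrapDefs.lean` (director-hodge g16 R16.47 (2)(c), seat
core-w3 g2; idea-crit-6 g4 ruling 26512-N1: «S3 is TRUE and size M»):

* `isSimple_of_endTrivial` — `End J = ℤ·𝟙 ⟹ J` simple (Poincaré's complete reducibility, Mumford §19 Thm. 1: an abelian subvariety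
  `i : Y ↪ J` with `0 < dim Y < dim J` has a complement `j : Z ↪ J` and a quasi-inverse `τ` of the isogeny `(i, j)`; the endomorphism
  `τ ≫ pr₂ ≫ j` is an integer `m`, and `m · i = 0`, `m · j = n · j` force `i = 0` or `j = 0`, contradicting `0 < dim Y`, `0 < dim Z`);
* `kSimple_of_endTrivial D : EndTrivial D → KSimple D` — S3. Let `f : B ↪ J × Ĵ` be a `φ_d`-stable abelian subvariety, `0 < dim B < 6`,
  `φ_d = (x, y) ↦ (−d·φ_Θ⁻¹ y, φ_Θ x)` (`weilOperator`, `φ_Θ : J ⥲ Ĵ` for the principal `Θ`), `a := f ≫ pr_J`, `b := f ≫ pr_Ĵ ≫ φ_Θ⁻¹ : B → J`.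
  Stability gives `ψ_B ≫ b = a` and `ψ_B ≫ a = −d · b`, so `a = 0 ⟹ b = 0 ⟹ f = 0`, impossible (`f ≠ 0` by Poincaré: `f ≫ τ ≫ pr₁ = n·𝟙_B`);
  hence `a ≠ 0` and `3 = dim J ≤ dim B` (`J` simple). If `dim B = 3`, `a` is an isogeny with quasi-inverse `a'` (`a a' = N`, `a' a = N`),
  and `End J = ℤ` makes `a' ≫ b = n·𝟙`, `a' ≫ ψ_B ≫ a = k·𝟙`; the two relations give `k = −d n` and `N² = k n`, i.e. `N² + d n² = 0` with
  `N > 0` — absurd (the printed «a `φ_d`-stable graph `{(a y, b y)}` would need `a² = −d b²` in `ℚ`»). If `dim B ∈ {4, 5}`, a Poincaré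
  complement `Z` of `B` in `J × Ĵ` has `0 < dim Z < 3`, so both its projections to the simple threefolds `J`, `Ĵ ≅ J` vanish and `Z ↪ J × Ĵ`
  is zero — absurd again.

Fact-free: Poincaré reducibility (`poincare_complete_reducibility`), quasi-inverses (`IsIsogeny.exists_nsmul_inverse_holds`), torsion-freeness of
`Hom` (`hom_eq_zero_of_nsmul_eq_zero`, `eq_zero_of_zsmul_eq_zero_of_isIsogeny`) and the simple-target lemmas (`dim_le_of_isSimple_of_ne_zero`,
`isIsogeny_of_isSimple_of_ne_zero_of_dim_eq`) are tree THEOREMS.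

References: [cite: MumfordAV1970, §19 Thm. 1 and Cor. 2 (pp. 173–174)] [cite: BirkenhakeLange2004, §5.3 (abelian subvarieties and idempotents of End_ℚ)]
[cite: Markman2025SecantWeil, §3.2 (the operator φ_d with φ_d² = −d)]
-/

noncomputable section

open CategoryTheory CategoryTheory.Limits AlgebraicGeometry Topology

namespace Summit.HodgeConjecture.HodgeConjecture.Ring2.SemiregularRepresentatives

set_option linter.dupNamespace false -- the cell's namespace repeats the summit name, as in every `Ring2*` file

namespace MoverTrap

open Literature.AlgebraicGeometry Literature.AlgebraicGeometry.Motives Literature.AlgebraicGeometry.Motives.AbelianVariety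
open Literature.AlgebraicGeometry.HodgeTheory Literature.AlgebraicGeometry.Markman2025
open Literature.AlgebraicTopology.SingularHomology

/-! ## §1 `End J = ℤ` ⟹ `J` simple -/

/-- **An abelian variety over `ℂ` all of whose endomorphisms are integers is simple.** Poincaré: a proper non-zero abelian subvariety
`i : Y ↪ J` has a complement `j : Z ↪ J`, `(i, j) : Y ⊞ Z → J` an isogeny with quasi-inverse `τ`; the integer `m` with
`τ ≫ pr₂ ≫ j = m·𝟙_J` satisfies `m·i = 0` and `m·j = n·j`, so `i = 0` (if `m ≠ 0`) or `j = 0` (if `m = 0`), contradicting `0 < dim Y`,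
`0 < dim Z`. [cite: MumfordAV1970, §19 Thm. 1 and Cor. 2 (pp. 173–174)] -/
theorem isSimple_of_endTrivial {J : AbelianVariety ℂ} (hEnd : ∀ f : J ⟶ J, ∃ n : ℤ, f = n • 𝟙 J) : IsSimple J := by
  by_contra hJ
  obtain ⟨Y, i, hi, hY0, hYJ⟩ := exists_abelianSubvariety_of_not_isSimple hJ
  haveI := hi
  obtain ⟨Z, j, -, hσ⟩ := poincare_complete_reducibility i
  obtain ⟨τ, n, hn, hστ, hτσ⟩ := IsIsogeny.exists_nsmul_inverse_holds hσ
  have hdim : Y.dim + Z.dim = J.dim := by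
    rw [← dim_biprod]
    exact dim_eq_of_isIsogeny hσ
  -- the retractions up to `n`
  have hri : i ≫ τ ≫ biprod.fst = n • 𝟙 Y := by
    rw [← biprod.inl_desc i j, Category.assoc, reassoc_of% hστ, Preadditive.nsmul_comp,
      Category.id_comp, Preadditive.comp_nsmul, biprod.inl_fst]
  have hrj : j ≫ τ ≫ biprod.snd = n • 𝟙 Z := by
    rw [← biprod.inr_desc i j, Category.assoc, reassoc_of% hστ, Preadditive.nsmul_comp,
      Category.id_comp, Preadditive.comp_nsmul, biprod.inr_snd]
  have hri0 : i ≫ τ ≫ biprod.snd = 0 := by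
    rw [← biprod.inl_desc i j, Category.assoc, reassoc_of% hστ, Preadditive.nsmul_comp,
      Category.id_comp, Preadditive.comp_nsmul, biprod.inl_snd, smul_zero]
  -- `i ≠ 0` and `j ≠ 0`
  have hi0 : i ≠ 0 := fun h0 => by
    rw [h0, Limits.zero_comp] at hri
    exact id_ne_zero_of_dim_pos hY0 (hom_eq_zero_of_nsmul_eq_zero hn.ne' hri.symm)
  have hZ0 : 0 < Z.dim := by omega
  have hj0 : j ≠ 0 := fun h0 => by
    rw [h0, Limits.zero_comp] at hrj
    exact id_ne_zero_of_dim_pos hZ0 (hom_eq_zero_of_nsmul_eq_zero hn.ne' hrj.symm)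
  -- the endomorphism `e₂ = τ pr₂ j` is an integer `m`
  obtain ⟨m, hm⟩ := hEnd (τ ≫ biprod.snd ≫ j)
  have hie : i ≫ (τ ≫ biprod.snd ≫ j) = 0 := by
    rw [show i ≫ (τ ≫ biprod.snd ≫ j) = (i ≫ τ ≫ biprod.snd) ≫ j by simp only [Category.assoc], hri0,
      Limits.zero_comp]
  have hje : j ≫ (τ ≫ biprod.snd ≫ j) = n • j := by
    rw [show j ≫ (τ ≫ biprod.snd ≫ j) = (j ≫ τ ≫ biprod.snd) ≫ j by simp only [Category.assoc], hrj,
      Preadditive.nsmul_comp, Category.id_comp]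
  rw [hm, Preadditive.comp_zsmul, Category.comp_id] at hie hje
  by_cases hm0 : m = 0
  · -- `n • j = 0`, so `j = 0`
    rw [hm0, zero_smul] at hje
    exact hj0 (hom_eq_zero_of_nsmul_eq_zero hn.ne' hje.symm)
  · -- `m • i = 0`, so `i = 0`
    exact hi0 (eq_zero_of_zsmul_eq_zero_of_isIsogeny (isIsogeny_zsmul_id_holds Y m hm0) hie)

/-! ## §2 S3: `End J = ℤ ⟹` K-simple -/

/-- **S3 — `EndTrivial D → KSimple D`**: if `End J = ℤ·𝟙` then `J × Ĵ` has no `φ_d`-stable abelian subvariety of dimension strictly between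
`0` and `dim (J × Ĵ) = 6` — the statement of the workfile's `stub_KSimple_of_endTrivial` VERBATIM. See the module docstring for the proof
(`φ_d`-stability ⟹ `ψ_B ≫ b = a`, `ψ_B ≫ a = −d·b`; `dim B = 3`: `N² + d n² = 0`; `dim B ∈ {4,5}`: the Poincaré complement is too small).
[cite: MumfordAV1970, §19 Thm. 1 and Cor. 2 (pp. 173–174)] [cite: BirkenhakeLange2004, §5.3 (abelian subvarieties and idempotents of End_ℚ)] -/
theorem kSimple_of_endTrivial (D : SecantQuotientDatum) : EndTrivial D → KSimple D := by
  intro hEnd B f hf hψ hB0 hB6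
  have hJ : IsSimple D.𝒥.J := isSimple_of_endTrivial hEnd
  have hJ3 : D.𝒥.J.dim = 3 := D.dim_J
  have hP6 : D.P.dim = 6 := D.dim_P
  have hd0 : D.d ≠ 0 := by have := D.four_le; omega
  haveI := D.𝒥.J.isIso_phiTheta_of_KTheta_eq_bot D.isAmple D.KTheta_eq_bot
  haveI := hf
  -- notation: the two projections of `P = J × Ĵ` (typed over `D.P`), `φ_Θ`, and the projections of `f`, the second one read in
  -- `J` through `φ_Θ⁻¹`
  set Jd : AbelianVariety ℂ := D.𝒥.J.dualOf D.Θ D.isAmple with hJd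
  set φ : D.𝒥.J ⟶ Jd := D.𝒥.J.phiTheta D.Θ D.isAmple with hφ
  set p₁ : D.P ⟶ D.𝒥.J := fst D.𝒥.J Jd with hp₁
  set p₂ : D.P ⟶ Jd := snd D.𝒥.J Jd with hp₂
  set a : B ⟶ D.𝒥.J := f ≫ p₁ with ha
  set b : B ⟶ D.𝒥.J := f ≫ p₂ ≫ inv φ with hb
  obtain ⟨ψB, hψB⟩ := hψ
  -- `φ_d` read on the two projections (`weilOperator_snd`, `weilOperator_fst`)
  have hψ_snd : D.ψ ≫ p₂ = p₁ ≫ φ := weilOperator_snd D.isAmple D.KTheta_eq_bot D.d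
  have hψ_fst : D.ψ ≫ p₁ = -((D.d : ℤ) • (p₂ ≫ inv φ)) := weilOperator_fst D.isAmple D.KTheta_eq_bot D.d
  -- `φ_d`-stability on the projections: `ψ_B ≫ b = a`, `ψ_B ≫ a = −d·b`
  have r1 : ψB ≫ b = a := by
    have h1 : ψB ≫ b = (ψB ≫ f) ≫ p₂ ≫ inv φ := by simp only [hb, Category.assoc]
    rw [h1, hψB, Category.assoc, ← Category.assoc D.ψ p₂ (inv φ), hψ_snd, Category.assoc, IsIso.hom_inv_id,
      Category.comp_id]
  have r2 : ψB ≫ a = -((D.d : ℤ) • b) := by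
    have h1 : ψB ≫ a = (ψB ≫ f) ≫ p₁ := by simp only [ha, Category.assoc]
    rw [h1, hψB, Category.assoc, hψ_fst, Preadditive.comp_neg, Preadditive.comp_zsmul]
  -- `f ≠ 0` (Poincaré: `f ≫ τ ≫ pr₁ = n·𝟙_B` with `0 < dim B`)
  obtain ⟨Z, j, hj, hσ⟩ := poincare_complete_reducibility f
  obtain ⟨τ, n, hn, hστ, hτσ⟩ := IsIsogeny.exists_nsmul_inverse_holds hσ
  have hrf : f ≫ τ ≫ biprod.fst = n • 𝟙 B := by
    rw [← biprod.inl_desc f j, Category.assoc, reassoc_of% hστ, Preadditive.nsmul_comp,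
      Category.id_comp, Preadditive.comp_nsmul, biprod.inl_fst]
  have hrj : j ≫ τ ≫ biprod.snd = n • 𝟙 Z := by
    rw [← biprod.inr_desc f j, Category.assoc, reassoc_of% hστ, Preadditive.nsmul_comp,
      Category.id_comp, Preadditive.comp_nsmul, biprod.inr_snd]
  have hf0 : f ≠ 0 := fun h0 => by
    rw [h0, Limits.zero_comp] at hrf
    exact id_ne_zero_of_dim_pos hB0 (hom_eq_zero_of_nsmul_eq_zero hn.ne' hrf.symm)
  have hdimZ : B.dim + Z.dim = D.P.dim := by
    rw [← dim_biprod]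
    exact dim_eq_of_isIsogeny hσ
  -- a homomorphism into `J × Ĵ` with both projections (the second read in `J`) zero is zero
  have hzero : ∀ {W : AbelianVariety ℂ} (g : W ⟶ D.𝒥.J.prod Jd), g ≫ p₁ = 0 → g ≫ p₂ ≫ inv φ = 0 → g = 0 := by
    intro W g h1 h2
    have h2' : g ≫ p₂ = 0 := by
      have h := congrArg (fun t => t ≫ φ) h2
      simpa only [Category.assoc, IsIso.inv_hom_id, Category.comp_id, Limits.zero_comp] using h
    exact prod_hom_ext (by rw [Limits.zero_comp]; exact h1) (by rw [Limits.zero_comp]; exact h2')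
  -- `a ≠ 0`
  have ha0 : a ≠ 0 := by
    intro ha0
    have hb0 : b = 0 := by
      have h : (D.d : ℤ) • b = 0 := by
        have h' := r2
        rw [ha0, Limits.comp_zero] at h'
        exact neg_eq_zero.mp h'.symm
      exact eq_zero_of_zsmul_eq_zero_of_isIsogeny (isIsogeny_zsmul_id_holds B (D.d : ℤ) (by exact_mod_cast hd0)) h
    exact hf0 (hzero f ha0 hb0)
  -- `3 ≤ dim B`
  have h3B : 3 ≤ B.dim := by rw [← hJ3]; exact dim_le_of_isSimple_of_ne_zero a hJ ha0
  by_cases hB3 : B.dim = 3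
  · -- `dim B = 3`: `a` is an isogeny; quasi-inverse `a'`
    have haiso : IsIsogeny a := isIsogeny_of_isSimple_of_ne_zero_of_dim_eq a hJ ha0 (by rw [hB3, hJ3])
    obtain ⟨a', N, hN, haa', ha'a⟩ := IsIsogeny.exists_nsmul_inverse_holds haiso
    obtain ⟨nb, hnb⟩ := hEnd (a' ≫ b)
    obtain ⟨k, hk⟩ := hEnd (a' ≫ ψB ≫ a)
    -- (E1) `k = −d nb`
    have E1 : (k + (D.d : ℤ) * nb) • 𝟙 D.𝒥.J = 0 := by
      have h : a' ≫ ψB ≫ a = -((D.d : ℤ) • (a' ≫ b)) := by rw [r2, Preadditive.comp_neg, Preadditive.comp_zsmul]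
      rw [hk, hnb, smul_smul] at h
      rw [add_smul, h, neg_add_cancel]
    -- (E2) `N² = k nb`
    have E2 : ((N : ℤ) * N - k * nb) • 𝟙 D.𝒥.J = 0 := by
      -- `X := a' ψB a a' b` computed two ways
      have way1 : a' ≫ ψB ≫ a ≫ a' ≫ b = (k * nb) • 𝟙 D.𝒥.J := by
        rw [show a' ≫ ψB ≫ a ≫ a' ≫ b = (a' ≫ ψB ≫ a) ≫ (a' ≫ b) by simp only [Category.assoc], hk, hnb,
          Preadditive.zsmul_comp, Category.id_comp, smul_smul]
      have way2 : a' ≫ ψB ≫ a ≫ a' ≫ b = ((N : ℤ) * N) • 𝟙 D.𝒥.J := by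
        rw [reassoc_of% haa', Preadditive.nsmul_comp, Category.id_comp, Preadditive.comp_nsmul, Preadditive.comp_nsmul, r1,
          ha'a, smul_smul, ← natCast_zsmul, Nat.cast_mul]
      rw [sub_smul, ← way2, way1, sub_self]
    have hid : 𝟙 D.𝒥.J ≠ 0 := id_ne_zero_of_dim_pos (by rw [hJ3]; norm_num)
    have i1 : k + (D.d : ℤ) * nb = 0 := by
      by_contra hne
      exact hid (eq_zero_of_zsmul_eq_zero_of_isIsogeny (isIsogeny_zsmul_id_holds D.𝒥.J _ hne) E1)
    have i2 : (N : ℤ) * N - k * nb = 0 := by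
      by_contra hne
      exact hid (eq_zero_of_zsmul_eq_zero_of_isIsogeny (isIsogeny_zsmul_id_holds D.𝒥.J _ hne) E2)
    have h3 : (N : ℤ) * N + (D.d : ℤ) * (nb * nb) = 0 := by linear_combination i2 + nb * i1
    have hsq : (0 : ℤ) < (N : ℤ) * N := mul_pos (by exact_mod_cast hN) (by exact_mod_cast hN)
    have hnn : (0 : ℤ) ≤ (D.d : ℤ) * (nb * nb) := mul_nonneg (by exact_mod_cast Nat.zero_le _) (mul_self_nonneg nb)
    linarith
  · -- `dim B ∈ {4, 5}`: the Poincaré complement `Z` of `B` has `0 < dim Z < 3`, so `Z ↪ J × Ĵ` vanishes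
    have hZlt : Z.dim < 3 := by omega
    have hZ0 : 0 < Z.dim := by omega
    have hj0 : j ≠ 0 := fun h0 => by
      rw [h0, Limits.zero_comp] at hrj
      exact id_ne_zero_of_dim_pos hZ0 (hom_eq_zero_of_nsmul_eq_zero hn.ne' hrj.symm)
    have hjz1 : j ≫ p₁ = 0 := by
      by_contra hne
      have := dim_le_of_isSimple_of_ne_zero (j ≫ p₁) hJ hne
      omega
    have hjz2 : j ≫ p₂ ≫ inv φ = 0 := by
      by_contra hne
      have := dim_le_of_isSimple_of_ne_zero (j ≫ p₂ ≫ inv φ) hJ hne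
      omega
    exact hj0 (hzero j hjz1 hjz2)

end MoverTrap

end Summit.HodgeConjecture.HodgeConjecture.Ring2.SemiregularRepresentatives

end
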